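import Summits.ValiantsHypothesis.ValiantsHypothesis.Theorems.LacunarySymmetroidMatrixDescartesCensusCUSoundDom

/-!
# `MatrixDescartes` census — soundness of the chamber-uniform checker, part 5: the rank rows `M4 = 0` vanish on pencils

HONEST FRAMING.  Object-search cell `pub-symmetroid`; door-A item `DoorA26 = PosRootLawAt 2 6 19`
(stmt-ValiantsHypothesis-19979; OPEN, typed, never asserted).  The one algebraic input of the rank rows: six real symmetric `2 × 2`
letters live in the `3`-space `Sym₂(ℝ)`, so every `4 × 4` minor of their Gram matrix `(B(S_i, S_j))` (polarised determinant) vanishes —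
here for the checker's term list `CU.m4Poly r c` under the atom valuation `V20.aval S` (`CU.pval_m4Poly`), including the bookkeeping
that merging equal monomials (`CU.mergeTerms`) does not change the value of a term list whose atoms are valid.  Nothing here bears on
`V = 19`, on `DoorA26` itself (OPEN), on `MatrixDescartes` (stmt-ValiantsHypothesis-18050) or on `VP ≠ VNP`.

[folklore] Certificate-checker soundness; elementary (a `24`-term polynomial identity by `ring`).
-/

-- the D-0017 layout repeats a namespace component (single-conjunct summit); the `dupNamespace` linter flags it; name mandated.
set_option linter.dupNamespace false

namespace Summit.ValiantsHypothesis.ValiantsHypothesis.Theorems.LacunarySymmetroidMatrixDescartes.Census.CU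

open V20 (Atom Term allAtoms qA cA pval tval aval bv qv)

/-! ## The Leibniz terms under the atom valuation -/

/-- The Gram entry in atoms: `aval (cA i j) · (2 if i = j) = β_ij` (`β_ii = 2 q_i`). [folklore] -/
theorem aval_cA_mul (S : Fin 6 → Matrix (Fin 2) (Fin 2) ℝ) (i j : ℕ) :
    aval S (cA i j) * (if i = j then 2 else 1) = bv S i j := by
  by_cases h : i = j
  · subst h
    have : cA i i = (i, i) := by simp [cA]
    rw [if_pos rfl, this]
    simp only [aval, if_true]
    unfold qv bv; ring
  · rw [if_neg h, mul_one, V20.aval_cA S h]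

/-- `2^{#filter} = ∏ (2 if p else 1)`. [folklore] -/
theorem two_pow_length_filter {α : Type*} (p : α → Prop) [DecidablePred p] : ∀ L : List α,
    (2 : ℝ) ^ (L.filter p).length = (L.map fun a => if p a then (2 : ℝ) else 1).prod
  | [] => by simp
  | a :: L => by
    by_cases h : p a
    · simp [h, pow_succ, two_pow_length_filter p L]; ring
    · simp [h, two_pow_length_filter p L]

/-- Value of one Leibniz term: `sgn π · ∏_a β(r_a, c_{π a})`. [folklore] -/
theorem tval_m4Term (S : Fin 6 → Matrix (Fin 2) (Fin 2) ℝ) (r c : List ℕ) (sp : ℤ × List ℕ) :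
    tval (aval S) (m4Term r c sp)
      = (sp.1 : ℝ) * ((List.range 4).map fun a => bv S (r.getD a 0) (c.getD (sp.2.getD a 0) 0)).prod := by
  unfold m4Term tval
  simp only [List.map_map]
  push_cast
  rw [two_pow_length_filter, mul_assoc, ← List.prod_map_mul]
  congr 1
  congr 1
  refine List.map_congr_left fun a _ => ?_
  simp only [Function.comp_apply]
  rw [mul_comm]
  exact aval_cA_mul S _ _

/-- **The `4 × 4` Gram minors vanish**: `Σ_π sgn π ∏_a β(r_a, c_{π a}) = 0` for any eight letters. [folklore] -/
theorem pval_perms4 (S : Fin 6 → Matrix (Fin 2) (Fin 2) ℝ) (r c : List ℕ) : pval (aval S) (perms4.map (m4Term r c)) = 0 := by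
  unfold pval
  simp only [List.map_map]
  have h4 : List.range 4 = [0, 1, 2, 3] := rfl
  simp only [perms4, List.map_cons, List.map_nil, List.sum_cons, List.sum_nil, Function.comp, tval_m4Term, h4,
    List.prod_cons, List.prod_nil, List.getD_cons_zero, List.getD_cons_succ]
  norm_num
  unfold bv
  ring

/-! ## Merging equal monomials does not change the value -/

/-- Codes of valid atoms determine the atom. [folklore] -/
def atomOfCode (n : ℕ) : Atom := (n / 6, n % 6)

/-- Decoding a valid atom's code. [folklore] -/
theorem atomOfCode_code {a : Atom} (ha : a ∈ allAtoms) : atomOfCode (6 * a.1 + a.2) = a := by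
  rw [V20.mem_allAtoms_iff] at ha
  obtain ⟨i, j⟩ := a
  simp only at ha ⊢
  unfold atomOfCode
  ext <;> simp <;> omega

/-- Insertion is a permutation. [folklore] -/
theorem perm_insNat (a : ℕ) : ∀ l : List ℕ, (insNat a l).Perm (a :: l)
  | [] => by simp [insNat]
  | b :: l => by
    unfold insNat
    split_ifs
    · exact List.Perm.refl _
    · exact ((perm_insNat a l).cons b).trans (List.Perm.swap a b l)

/-- The sorted key is a permutation of the codes. [folklore] -/
theorem perm_atomKey (A : List Atom) : (atomKey A).Perm (A.map fun a => 6 * a.1 + a.2) := by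
  unfold atomKey
  generalize A.map (fun a => 6 * a.1 + a.2) = L
  induction L with
  | nil => simp
  | cons a L ih => exact (perm_insNat a _).trans (ih.cons a)

/-- Monomials with equal keys (valid atoms) have equal values. [folklore] -/
theorem prod_eq_of_atomKey_eq (v : Atom → ℝ) {A B : List Atom} (hA : ∀ a ∈ A, a ∈ allAtoms) (hB : ∀ a ∈ B, a ∈ allAtoms)
    (h : atomKey A = atomKey B) : (A.map v).prod = (B.map v).prod := by
  have e : ∀ C : List Atom, (∀ a ∈ C, a ∈ allAtoms) → C.map v = (C.map fun a => 6 * a.1 + a.2).map (v ∘ atomOfCode) := by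
    intro C hC
    rw [List.map_map]
    exact List.map_congr_left fun a ha => by simp [Function.comp, atomOfCode_code (hC a ha)]
  rw [e A hA, e B hB]
  exact (((perm_atomKey A).symm.trans (h ▸ perm_atomKey B)).map _).prod_eq

/-- `addTerm` adds the value of the term (valid atoms). [folklore] -/
theorem pval_addTerm (v : Atom → ℝ) : ∀ (L : List Term) (T : Term), (∀ U ∈ L, ∀ a ∈ U.2, a ∈ allAtoms) →
    (∀ a ∈ T.2, a ∈ allAtoms) → pval v (addTerm L T) = pval v L + tval v T
  | [], T, _, _ => by simp [addTerm, pval]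
  | U :: L, T, hL, hT => by
    unfold addTerm
    split_ifs with hk
    · simp only [pval, List.map_cons, List.sum_cons, tval]
      rw [prod_eq_of_atomKey_eq v (hL U (by simp)) hT hk]
      push_cast; ring
    · have ih := pval_addTerm v L T (fun U' hU' => hL U' (by simp [hU'])) hT
      simp only [pval, List.map_cons, List.sum_cons] at ih ⊢
      rw [ih]; ring

/-- Atoms of `addTerm L T` are atoms of `L` or of `T`. [folklore] -/
theorem atoms_addTerm : ∀ (L : List Term) (T : Term), (∀ U ∈ L, ∀ a ∈ U.2, a ∈ allAtoms) → (∀ a ∈ T.2, a ∈ allAtoms) →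
    ∀ U ∈ addTerm L T, ∀ a ∈ U.2, a ∈ allAtoms
  | [], T, _, hT => by
    intro U hU a ha
    simp only [addTerm, List.mem_singleton] at hU
    subst hU; exact hT a ha
  | U :: L, T, hL, hT => by
    unfold addTerm
    split_ifs
    · intro U' hU'
      rcases List.mem_cons.1 hU' with rfl | h
      · exact hL U (by simp)
      · exact hL U' (by simp [h])
    · intro U' hU'
      rcases List.mem_cons.1 hU' with rfl | h
      · exact hL U' (by simp)
      · exact atoms_addTerm L T (fun W hW => hL W (by simp [hW])) hT U' h

/-- Folding `addTerm` adds the values. [folklore] -/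
theorem pval_foldl_addTerm (v : Atom → ℝ) : ∀ (P acc : List Term), (∀ U ∈ acc, ∀ a ∈ U.2, a ∈ allAtoms) →
    (∀ T ∈ P, ∀ a ∈ T.2, a ∈ allAtoms) → pval v (P.foldl addTerm acc) = pval v acc + pval v P
  | [], acc, _, _ => by simp [pval]
  | T :: P, acc, hacc, hP => by
    rw [List.foldl_cons, pval_foldl_addTerm v P _ (atoms_addTerm acc T hacc (hP T (by simp))) (fun T' hT' => hP T' (by simp [hT'])),
      pval_addTerm v acc T hacc (hP T (by simp))]
    simp [pval]; ring

/-- Dropping zero coefficients does not change the value. [folklore] -/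
theorem pval_filter_ne_zero (v : Atom → ℝ) : ∀ P : List Term, pval v (P.filter fun T => T.1 ≠ 0) = pval v P
  | [] => by simp [pval]
  | T :: P => by
    rw [List.filter_cons]
    have ih := pval_filter_ne_zero v P
    simp only [pval, List.map_cons, List.sum_cons] at ih ⊢
    split_ifs with h
    · simp only [List.map_cons, List.sum_cons]; rw [ih]
    · simp only [decide_eq_true_eq, not_not] at h
      rw [ih]; simp [tval, h]

/-- **Merging preserves the value** (valid atoms). [folklore] -/
theorem pval_mergeTerms (v : Atom → ℝ) (P : List Term) (hP : ∀ T ∈ P, ∀ a ∈ T.2, a ∈ allAtoms) :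
    pval v (mergeTerms P) = pval v P := by
  rw [mergeTerms, pval_filter_ne_zero, pval_foldl_addTerm v P [] (by simp) hP]; simp [pval]

/-! ## The rank rows under the atom valuation of a pencil -/

/-- Entries (with default `0`) of a list of letters `< 6` are `< 6`. [folklore] -/
theorem getD_lt_six {l : List ℕ} (h : ∀ i ∈ l, i < 6) (k : ℕ) : l.getD k 0 < 6 := by
  rcases Nat.lt_or_ge k l.length with hk | hk
  · rw [List.getD_eq_getElem _ _ hk]; exact h _ (List.getElem_mem hk)
  · rw [List.getD_eq_default _ _ hk]; norm_num

/-- Atoms of the Leibniz terms are valid when the letters are `< 6`. [folklore] -/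
theorem atoms_m4Term {r c : List ℕ} (hr : ∀ i ∈ r, i < 6) (hc : ∀ i ∈ c, i < 6) (sp : ℤ × List ℕ) :
    ∀ a ∈ (m4Term r c sp).2, a ∈ allAtoms := by
  intro a ha
  unfold m4Term at ha
  simp only [List.mem_map, List.mem_range] at ha
  obtain ⟨k, -, rfl⟩ := ha
  exact V20.cA_mem (getD_lt_six hr k) (getD_lt_six hc _)

/-- **`M4(r | c)` vanishes on every pencil.** [folklore] -/
theorem pval_m4Poly (S : Fin 6 → Matrix (Fin 2) (Fin 2) ℝ) {r c : List ℕ} (hr : ∀ i ∈ r, i < 6) (hc : ∀ i ∈ c, i < 6) :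
    pval (aval S) (m4Poly r c) = 0 := by
  rw [m4Poly, pval_mergeTerms _ _ (fun T hT => by
    rw [List.mem_map] at hT
    obtain ⟨sp, -, rfl⟩ := hT
    exact atoms_m4Term hr hc sp)]
  exact pval_perms4 S r c

end Summit.ValiantsHypothesis.ValiantsHypothesis.Theorems.LacunarySymmetroidMatrixDescartes.Census.CU
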